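import Literature.NumberTheory.IwasawaTheory.NarrowFukudaCertificateCompleteness
import Literature.NumberTheory.IwasawaTheory.NarrowFukudaCertificateLayerPolynomialModels
import HarnessLib

/-!
# Completeness of the narrow rank certificate for ALL cyclotomic `ℤ₂`-extensions of a field at once: «narrow `μ₂ = 0`» (Kida-lite's
# hypotheses (a) ∧ (b), uniformly in the cyclotomic `κ`) ⟺ «some rung `m ≥ m₀` fires for every cyclotomic `κ`»; cubic fields: `m₀ = 1`

Topic `NumberTheory/IwasawaTheory` (namespace = path). THEOREM-ONLY file (no definition, no named fact, no `sorry`), written by the prover seat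
`cruxlead-stmt-BirchSwinnertonDyer-19573-w2` GEN 11 (cell `bsd-2adic`; `--supports` stmt-BirchSwinnertonDyer-19573; closes nothing).  Assembly of
`NarrowFukudaCertificateCompleteness` (one `κ`: (a) ∧ (b) ⟺ a stabilising pair) with the uniformity-in-`κ` lemmas of `NarrowFukudaCertificateLayerPolynomialModels`
(two cyclotomic `κ` have the same layers, `index_range_pow_narrowClassGroup_layer_eq_of_isCyclotomic`; the rung-`m` certificate `NarrowFukuda.narrowMu_of_index_le_of_succ_eq`).

* ★ **`NarrowFukuda.narrowMu_iff_exists_succ_eq_of_index_le`** — for a number field `F` and `m₀` with Fukuda index `≤ m₀` for every cyclotomic `ℤ₂`-extension: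
  «(∀ cyclotomic `κ`, `μ₂(κ) = 0`) ∧ (∃ `D`, ∀ cyclotomic `κ`, ∀ layers, `ord₂ h⁺ ≤ ord₂ h + D`)» ⟺ «∃ `m ≥ m₀`, ∀ cyclotomic `κ`,
  `[Cl⁺(κ.layer (m+1)) : (Cl⁺)²] = [Cl⁺(κ.layer m) : (Cl⁺)²]`» — the hypotheses `hμ`, `D`, `hδ` of the Kida-lite doors (`NarrowMu.conjA_two_of_narrowMu_pointField`) and the
  hypothesis of the rung doors (`NarrowRankRung.conjA_two_…_layer_succ_eq`, `fineSelmerConjATwoOrdPosDisc_of_exists_narrowRank_layer_succ_eq`) are EQUIVALENT.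
* ★ **`NarrowFukuda.narrowMu_iff_exists_succ_eq_of_finrank_eq_three`** — cubic fields (`m₀ = 1`, tree `forall_totallyRamifiedFrom_one_of_finrank_eq_three`): no index hypothesis.
* `NarrowFukuda.narrowMu_iff_exists_succ_eq_of_finrank_lt` — odd degree `< 2^{m₀+1}`.

Nothing is asserted about any field.  BSD is not proved by any of this.

References: [Fukuda1994] Thm. 1 (2), p. 264; [Washington1997] §13.1, §13.3 Prop. 13.22–13.23; [Kida1982JFields] (μ-part; shape); [GreenbergLNM1716] §5, p. 122.
-/

set_option autoImplicit false

noncomputable section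

open scoped NumberField

namespace Literature.NumberTheory.IwasawaTheory

open Literature.NumberTheory.EllipticCurves Literature.NumberTheory.NumberFields Literature.NumberTheory.GaloisRepresentations NumberField

/-- ★ **KIDA-LITE'S HYPOTHESES FOR EVERY CYCLOTOMIC `ℤ₂`-EXTENSION ⟺ A COMMON RUNG.**  Let `F` be a number field and `m₀ : ℕ` such that every cyclotomic `ℤ₂`-extension of
`F` has Fukuda index `≤ m₀`.  Then: «(a) `ClassicalMuVanishes κ` for every cyclotomic `κ` ∧ (b) for some `D`, `ord₂ h⁺(κ.layer j) ≤ ord₂ h(κ.layer j) + D` for every cyclotomic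
`κ` and every `j` (any `NumberField` instance)» iff «for some `m ≥ m₀`, every cyclotomic `κ` has `[Cl⁺(κ.layer (m+1)) : (Cl⁺)²] = [Cl⁺(κ.layer m) : (Cl⁺)²]` (any instances)».
⟸ is the rung-`m` certificate (`NarrowFukuda.narrowMu_of_index_le_of_succ_eq`); ⟹: for one cyclotomic `κ₀`, (a) ∧ (b) ⟺ a stabilising pair
(`NarrowFukuda.classicalMuVanishes_and_narrowDefect_le_iff_exists_succ_eq`), and all cyclotomic `κ` share their layers. [cite: Fukuda1994, Thm. 1 (2), p. 264]
[cite: Washington1997, §13.3 Prop. 13.22–13.23] [cite: Kida1982JFields, main theorem (μ-part; shape only)] -/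
theorem NarrowFukuda.narrowMu_iff_exists_succ_eq_of_index_le (F : Type) [Field F] [NumberField F] (m₀ : ℕ)
    (hidx : ∀ κ : ZpExtension F 2, κ.IsCyclotomic → TotallyRamifiedFrom κ m₀) :
    ((∀ κ : ZpExtension F 2, κ.IsCyclotomic → ClassicalMuVanishes κ) ∧
      ∃ D : ℕ, ∀ κ : ZpExtension F 2, κ.IsCyclotomic → ∀ j : ℕ, ∀ [NumberField (κ.layer j)],
        padicValNat 2 (narrowClassNumber (κ.layer j)) ≤ padicValNat 2 (classNumber (κ.layer j)) + D) ↔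
    ∃ m, m₀ ≤ m ∧ ∀ κ : ZpExtension F 2, κ.IsCyclotomic → ∀ [NumberField (κ.layer m)] [NumberField (κ.layer (m + 1))],
      (powMonoidHom (α := NarrowClassGroup (κ.layer (m + 1))) 2).range.index =
        (powMonoidHom (α := NarrowClassGroup (κ.layer m)) 2).range.index := by
  haveI : Fact (Nat.Prime 2) := ⟨Nat.prime_two⟩
  constructor
  · rintro ⟨hμ, D, hδ⟩
    by_cases hex : ∃ κ₀ : ZpExtension F 2, κ₀.IsCyclotomic
    · obtain ⟨κ₀, hκ₀⟩ := hex
      obtain ⟨m, hm, heq⟩ := (NarrowFukuda.classicalMuVanishes_and_narrowDefect_le_iff_exists_succ_eq κ₀ (hidx κ₀ hκ₀)).mp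
        ⟨hμ κ₀ hκ₀, D, hδ κ₀ hκ₀⟩
      refine ⟨m, hm, fun κ hκ _ _ => ?_⟩
      haveI : FiniteDimensional F (κ₀.layer m) := κ₀.finiteDimensional_layer_holds m
      haveI : FiniteDimensional F (κ₀.layer (m + 1)) := κ₀.finiteDimensional_layer_holds (m + 1)
      haveI : NumberField (κ₀.layer m) := NumberField.of_module_finite F _
      haveI : NumberField (κ₀.layer (m + 1)) := NumberField.of_module_finite F _
      rw [index_range_pow_narrowClassGroup_layer_eq_of_isCyclotomic κ₀ κ hκ₀ hκ (m + 1) 2,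
        index_range_pow_narrowClassGroup_layer_eq_of_isCyclotomic κ₀ κ hκ₀ hκ m 2]
      exact heq
    · exact ⟨m₀, le_rfl, fun κ hκ => (hex ⟨κ, hκ⟩).elim⟩
  · rintro ⟨m, hm, hcert⟩
    exact NarrowFukuda.narrowMu_of_index_le_of_succ_eq F m (fun κ hκ => (hidx κ hκ).mono hm) hcert

/-- ★ **CUBIC FIELDS: Kida-lite's hypotheses for every cyclotomic `ℤ₂`-extension ⟺ some rung `m ≥ 1` fires** (Fukuda index `≤ 1` is automatic,
`forall_totallyRamifiedFrom_one_of_finrank_eq_three`).  So for the `0 < Δ` cell the road «narrow `μ₂(ℚ(P)) = 0`» (GEN 8) and the road «a stabilising pair of narrow `2`-ranks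
in the cubic tower `ℚ(P)_j`, `j ≥ 1`» (GEN 11) are the SAME road. [cite: Fukuda1994, Thm. 1 (2), p. 264] [cite: Washington1997, §13.1 and Lemma 13.3] -/
theorem NarrowFukuda.narrowMu_iff_exists_succ_eq_of_finrank_eq_three (F : Type) [Field F] [NumberField F] (h3 : Module.finrank ℚ F = 3) :
    ((∀ κ : ZpExtension F 2, κ.IsCyclotomic → ClassicalMuVanishes κ) ∧
      ∃ D : ℕ, ∀ κ : ZpExtension F 2, κ.IsCyclotomic → ∀ j : ℕ, ∀ [NumberField (κ.layer j)],
        padicValNat 2 (narrowClassNumber (κ.layer j)) ≤ padicValNat 2 (classNumber (κ.layer j)) + D) ↔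
    ∃ m, 1 ≤ m ∧ ∀ κ : ZpExtension F 2, κ.IsCyclotomic → ∀ [NumberField (κ.layer m)] [NumberField (κ.layer (m + 1))],
      (powMonoidHom (α := NarrowClassGroup (κ.layer (m + 1))) 2).range.index =
        (powMonoidHom (α := NarrowClassGroup (κ.layer m)) 2).range.index :=
  NarrowFukuda.narrowMu_iff_exists_succ_eq_of_index_le F 1 (forall_totallyRamifiedFrom_one_of_finrank_eq_three h3)

/-- **Odd degree `< 2^{m₀+1}`: Kida-lite's hypotheses ⟺ some rung `m ≥ m₀` fires** (index `≤ m₀` by `forall_totallyRamifiedFrom_of_finrank_lt`).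
[cite: Fukuda1994, Thm. 1 (2), p. 264] [cite: Washington1997, §13.1 and Lemma 13.3] -/
theorem NarrowFukuda.narrowMu_iff_exists_succ_eq_of_finrank_lt (F : Type) [Field F] [NumberField F] (hF : ¬ 2 ∣ Module.finrank ℚ F)
    (m₀ : ℕ) (hlt : Module.finrank ℚ F < 2 ^ (m₀ + 1)) :
    ((∀ κ : ZpExtension F 2, κ.IsCyclotomic → ClassicalMuVanishes κ) ∧
      ∃ D : ℕ, ∀ κ : ZpExtension F 2, κ.IsCyclotomic → ∀ j : ℕ, ∀ [NumberField (κ.layer j)],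
        padicValNat 2 (narrowClassNumber (κ.layer j)) ≤ padicValNat 2 (classNumber (κ.layer j)) + D) ↔
    ∃ m, m₀ ≤ m ∧ ∀ κ : ZpExtension F 2, κ.IsCyclotomic → ∀ [NumberField (κ.layer m)] [NumberField (κ.layer (m + 1))],
      (powMonoidHom (α := NarrowClassGroup (κ.layer (m + 1))) 2).range.index =
        (powMonoidHom (α := NarrowClassGroup (κ.layer m)) 2).range.index :=
  NarrowFukuda.narrowMu_iff_exists_succ_eq_of_index_le F m₀ (forall_totallyRamifiedFrom_of_finrank_lt hF m₀ hlt)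

end Literature.NumberTheory.IwasawaTheory

end
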